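import Summits.ValiantsHypothesis.ValiantsHypothesis.Theorems.SymmetroidPencilBasics
import Summits.ValiantsHypothesis.ValiantsHypothesis.Theorems.ValuativeGCTValuativeFlipCyclicTridiagonalContinuant

/-!
# Route «KPlusLogSqLaw», crux `WeakLifting` (stmt-ValiantsHypothesis-19561) — REAL side of the tridiagonal sector:
# the CONTINUANT NORMAL FORM of a tridiagonal (in particular a static tridiagonal lacunary) pencil

HONEST FRAMING.  Helper theorems (`--supports stmt-ValiantsHypothesis-19561 --as helper`) for the REAL side of the
witness-plan stub `stub_tridiagonalSectorB` (`Cruxes/WeakLifting/Lines/birth.lean`).  Seat val-sym-lift-p3 (g8), cell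
`pub-symmetroid`, 2026-08-27, desk R2102 (2) «NORMAL FORM … GO to kernel it».  Pure bookkeeping algebra over a commutative
ring: nothing here bounds anything; nothing bears on `WeakLifting`, on Conjecture B, on `TropicalB` (stmt-19771), on
`MatrixDescartes` (stmt-18050) or on VP ≠ VNP.

WHAT IS PROVED (any commutative ring `R`, any size `k`; NO new definitions — the tree's path matrix `ValuativeFlip.ctPath`
and continuant `ValuativeFlip.ctK` (permanental, `K_{t+2} = L (t+1) K_{t+1} + M t · M' (t+1) · K_t`) are reused, the determinant
being the continuant with NEGATED superdiagonal data: `K_{t+2} = L (t+1) K_{t+1} − M t · M' (t+1) · K_t`).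
1. `det_ctPath`: `(ctPath L M M' k).det = ctK L (fun t => -M t) M' k` — Laplace expansion along the last row (Mathlib
   `Matrix.det_succ_row` / `Matrix.det_succ_column`), the determinantal twin of the tree's `ValuativeFlip.ct_permanent_ctPath`
   (cofactor sign `−1` on the link term).
2. `eq_ctPath_of_tridiagonal` / `det_of_tridiagonal`: EVERY matrix `A : Matrix (Fin k) (Fin k) R` whose entries vanish off the band
   (`(i : ℕ) + 1 < j ∨ (j : ℕ) + 1 < i → A i j = 0`, the stub's predicate verbatim) is `ctPath` of its three diagonals (written as
   explicit `dite` sequences, no auxiliary definition), hence `A.det` = the continuant of its diagonal entries and NEGATED link products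
   `D₀ = 1`, `D₁ = A₀₀`, `D_{t+2} = A_{t+1,t+1} D_{t+1} − A_{t,t+1} A_{t+1,t} D_t`.
3. `det_pencil_of_tridiagonal`: for a lacunary pencil `∑ l, X ^ (d l) • (S l).map C` with every `S l` tridiagonal the determinant is that
   continuant of the pencil's diagonal entries and link products (polynomials) — the NORMAL FORM behind the located/kernel rows of this
   lineage (`…TridiagonalRealStaticFive`: five positive zeros on four edges): for a STATIC pencil (one class per entry) every diagonal entry
   and every link product is a single monomial, so for `x > 0` one may divide by the diagonal monomials and obtain the edge-weight recursion
   `p_t = p_{t−1} − W_{t−1} p_{t−2}` of the seat memo (that division is left to the analytic files that need it).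
[folklore] three-term recurrence of tridiagonal determinants (continuants; Muir, *Theory of determinants*, ch. «Continuants»).
-/

-- `Summit.ValiantsHypothesis.ValiantsHypothesis.…` repeats a component by the D-0017 layout
-- (single-conjunct summit), which the `dupNamespace` linter flags; the name is mandated.
set_option linter.dupNamespace false

namespace Summit.ValiantsHypothesis.ValiantsHypothesis.Theorems.KPlusLogSqLaw.StaticTridiagonalReal

open scoped BigOperators Matrix
open Finset
open Summit.ValiantsHypothesis.ValiantsHypothesis.Theorems.ValuativeFlip (ctK ctPath ctPath_apply
  ctPath_submatrix_castSucc ctK_add_two)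


section Path

variable {R : Type*} [CommRing R]

/-- **Determinant of a path-tridiagonal matrix = continuant with negated superdiagonal**:
`det (ctPath L M M' k) = ctK L (−M) M' k`, i.e. `D_{t+2} = L (t+1) D_{t+1} − M t · M' (t+1) · D_t`.
Laplace expansion along the last row: the diagonal entry leaves the shorter path; the subdiagonal entry `M' (k+1)`
(cofactor sign `−1`) leaves a minor whose last column has the single entry `M k` in front of the path shortened by two.
[folklore] -/
theorem det_ctPath (L M M' : ℕ → R) :
    ∀ k : ℕ, (ctPath L M M' k).det = ctK L (fun t => -M t) M' k := by
  intro k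
  induction k using Nat.strong_induction_on with
  | _ k ih =>
    rcases k with _ | _ | k
    · exact Matrix.det_isEmpty
    · show (ctPath L M M' 1).det = ctK L (fun t => -M t) M' 1
      rw [Matrix.det_fin_one]
      simp [ctPath_apply]
    · set A := ctPath L M M' (k + 2) with hA
      -- entries of the last row
      have hrow : ∀ y : Fin (k + 2), A (Fin.last (k + 1)) y =
          if (y : ℕ) = k + 1 then L (k + 1) else if (y : ℕ) = k then M' (k + 1) else 0 := by
        intro y
        have hyk : (y : ℕ) < k + 2 := y.isLt
        simp only [hA, ctPath_apply, Fin.val_last]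
        by_cases h1 : (y : ℕ) = k + 1
        · rw [if_pos h1, if_pos h1]
        · rw [if_neg h1, if_neg (by omega), if_neg h1]
          by_cases h2 : (y : ℕ) = k
          · rw [if_pos (by omega), if_pos h2]
          · rw [if_neg (by omega), if_neg h2]
      rw [Matrix.det_succ_row A (Fin.last (k + 1))]
      -- only the last two columns contribute
      have hsplit : ∑ j : Fin (k + 2), (-1) ^ ((Fin.last (k + 1) : ℕ) + (j : ℕ)) * A (Fin.last (k + 1)) j *
            (A.submatrix (Fin.last (k + 1)).succAbove j.succAbove).det =
          ∑ j ∈ ({Fin.castSucc (Fin.last k), Fin.last (k + 1)} : Finset (Fin (k + 2))),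
            (-1) ^ ((Fin.last (k + 1) : ℕ) + (j : ℕ)) * A (Fin.last (k + 1)) j *
              (A.submatrix (Fin.last (k + 1)).succAbove j.succAbove).det := by
        symm
        refine Finset.sum_subset (Finset.subset_univ _) fun y _ hy => ?_
        simp only [Finset.mem_insert, Finset.mem_singleton, not_or] at hy
        have hy1 : (y : ℕ) ≠ k := fun h => hy.1 (Fin.ext (by simp [h]))
        have hy2 : (y : ℕ) ≠ k + 1 := fun h => hy.2 (Fin.ext (by simp [h]))
        rw [hrow y, if_neg hy2, if_neg hy1, mul_zero, zero_mul]
      rw [hsplit, Finset.sum_pair (by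
        intro h
        have := congrArg Fin.val h
        simp at this)]
      -- the two surviving entries and their signs
      have e1 : A (Fin.last (k + 1)) (Fin.castSucc (Fin.last k)) = M' (k + 1) := by
        rw [hrow, if_neg (by simp), if_pos (by simp)]
      have e2 : A (Fin.last (k + 1)) (Fin.last (k + 1)) = L (k + 1) := by
        rw [hrow, if_pos (by simp)]
      have s1 : ((-1 : R)) ^ ((Fin.last (k + 1) : ℕ) + (Fin.castSucc (Fin.last k) : ℕ)) = -1 := by
        rw [Fin.val_last, Fin.val_castSucc, Fin.val_last, show k + 1 + k = 2 * k + 1 by ring, pow_succ, pow_mul]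
        simp
      have s2 : ((-1 : R)) ^ ((Fin.last (k + 1) : ℕ) + (Fin.last (k + 1) : ℕ)) = 1 := by
        rw [Fin.val_last, ← two_mul, pow_mul]
        simp
      -- the diagonal minor is the shorter path
      have m2 : A.submatrix (Fin.last (k + 1)).succAbove (Fin.last (k + 1)).succAbove = ctPath L M M' (k + 1) := by
        rw [Fin.succAbove_last, hA, ctPath_submatrix_castSucc]
      -- the off-diagonal minor: expand along its last column
      set B := A.submatrix (Fin.last (k + 1)).succAbove (Fin.castSucc (Fin.last k)).succAbove with hB
      have hBcol : ∀ x : Fin (k + 1), B x (Fin.last k) = if (x : ℕ) = k then M k else 0 := by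
        intro x
        have hx : (x : ℕ) < k + 1 := x.isLt
        have hsa : ((Fin.castSucc (Fin.last k)).succAbove (Fin.last k) : ℕ) = k + 1 := by
          rw [Fin.succAbove_of_le_castSucc _ _ le_rfl]
          simp
        simp only [hB, Matrix.submatrix_apply, Fin.succAbove_last, hA, ctPath_apply, Fin.val_castSucc, hsa]
        by_cases hxk : (x : ℕ) = k
        · rw [if_neg (by omega), if_pos (by omega), if_pos hxk, hxk]
        · rw [if_neg (by omega), if_neg (by omega), if_neg (by omega), if_neg hxk]
      have hBsub : B.submatrix (Fin.last k).succAbove (Fin.last k).succAbove = ctPath L M M' k := by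
        ext x y
        have hy : ((Fin.castSucc (Fin.last k)).succAbove (Fin.castSucc y) : ℕ) = y := by
          rw [Fin.succAbove_of_castSucc_lt _ _ (by
            rw [Fin.castSucc_lt_castSucc_iff]; exact Fin.castSucc_lt_last y)]
          simp
        simp only [hB, Matrix.submatrix_apply, Fin.succAbove_last, hA, ctPath_apply, Fin.val_castSucc, hy]
      have hdetB : B.det = M k * ctK L (fun t => -M t) M' k := by
        rw [Matrix.det_succ_column B (Fin.last k), Fin.sum_univ_castSucc]
        have hzero : ∑ x : Fin k, (-1) ^ ((Fin.castSucc x : ℕ) + (Fin.last k : ℕ)) * B (Fin.castSucc x) (Fin.last k) *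
            (B.submatrix (Fin.castSucc x).succAbove (Fin.last k).succAbove).det = 0 := by
          refine Finset.sum_eq_zero fun x _ => ?_
          rw [hBcol, if_neg (by simp; omega), mul_zero, zero_mul]
        have s3 : ((-1 : R)) ^ ((Fin.last k : ℕ) + (Fin.last k : ℕ)) = 1 := by
          rw [Fin.val_last, ← two_mul, pow_mul]
          simp
        rw [hzero, zero_add, hBcol, if_pos (by simp), hBsub, ih k (by omega), s3, one_mul]
      rw [e1, e2, s1, s2, m2, ih (k + 1) (by omega), hdetB, ctK_add_two]
      ring

/-- **A tridiagonal matrix is the path matrix of its three diagonals** (tridiagonality spelled as in the registered stub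
`stub_tridiagonalSectorB`: entries with `|i − j| ≥ 2` vanish; the three diagonals are read off as `ℕ`-indexed sequences extended by `0`).
[folklore] -/
theorem eq_ctPath_of_tridiagonal {k : ℕ} (A : Matrix (Fin k) (Fin k) R)
    (htri : ∀ i j : Fin k, (i : ℕ) + 1 < j ∨ (j : ℕ) + 1 < i → A i j = 0) :
    A = ctPath (fun t => if h : t < k then A ⟨t, h⟩ ⟨t, h⟩ else 0)
      (fun t => if h : t + 1 < k then A ⟨t, by omega⟩ ⟨t + 1, h⟩ else 0)
      (fun t => if h : 1 ≤ t ∧ t < k then A ⟨t, h.2⟩ ⟨t - 1, by omega⟩ else 0) k := by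
  ext x y
  rw [ctPath_apply]
  by_cases h1 : (y : ℕ) = x
  · rw [if_pos h1, dif_pos x.isLt]
    have hy : y = x := Fin.ext h1
    subst hy
    rfl
  · rw [if_neg h1]
    by_cases h2 : (y : ℕ) = x + 1
    · have hlt : (x : ℕ) + 1 < k := h2 ▸ y.isLt
      rw [if_pos h2, dif_pos hlt]
      have hy : y = ⟨(x : ℕ) + 1, hlt⟩ := Fin.ext h2
      subst hy
      rfl
    · rw [if_neg h2]
      by_cases h3 : (x : ℕ) = y + 1
      · rw [if_pos h3, dif_pos ⟨by omega, x.isLt⟩]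
        exact congrArg₂ A (Fin.ext rfl) (Fin.ext (by simp only; omega))
      · rw [if_neg h3]
        exact htri x y (by omega)

/-- **CONTINUANT NORMAL FORM of a tridiagonal determinant**: for every `k × k` matrix whose entries vanish off the band,
`det A = D_k` with `D₀ = 1`, `D₁ = A₀₀`, `D_{t+2} = A_{t+1,t+1} D_{t+1} − A_{t,t+1} A_{t+1,t} D_t` (the tree's continuant `ctK` fed with
the diagonal, the NEGATED superdiagonal and the subdiagonal of `A`). [folklore] -/
theorem det_of_tridiagonal {k : ℕ} (A : Matrix (Fin k) (Fin k) R)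
    (htri : ∀ i j : Fin k, (i : ℕ) + 1 < j ∨ (j : ℕ) + 1 < i → A i j = 0) :
    A.det = ctK (fun t => if h : t < k then A ⟨t, h⟩ ⟨t, h⟩ else 0)
      (fun t => -(if h : t + 1 < k then A ⟨t, by omega⟩ ⟨t + 1, h⟩ else 0))
      (fun t => if h : 1 ≤ t ∧ t < k then A ⟨t, h.2⟩ ⟨t - 1, by omega⟩ else 0) k := by
  conv_lhs => rw [eq_ctPath_of_tridiagonal A htri]
  exact det_ctPath _ _ _ k

end Path

section Pencil

open Polynomial

/-- A lacunary pencil with tridiagonal coefficients is a tridiagonal polynomial matrix. [folklore] -/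
theorem pencil_tridiagonal {m K : ℕ} (d : Fin K → ℕ) (S : Fin K → Matrix (Fin m) (Fin m) ℝ)
    (htri : ∀ l (i j : Fin m), (i : ℕ) + 1 < j ∨ (j : ℕ) + 1 < i → S l i j = 0)
    (i j : Fin m) (hij : (i : ℕ) + 1 < j ∨ (j : ℕ) + 1 < i) :
    (∑ l, (X : ℝ[X]) ^ d l • (S l).map C) i j = 0 := by
  simp [Matrix.sum_apply, htri _ i j hij]

/-- **CONTINUANT NORMAL FORM of a tridiagonal lacunary pencil** (the sector of `stub_tridiagonalSectorB`): its determinant is the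
continuant `D_{t+2} = F_{t+1,t+1} D_{t+1} − F_{t,t+1} F_{t+1,t} D_t` of the polynomial matrix `F = ∑ l, X ^ (d l) • S l`, whose diagonal
entries are `∑ l, S l t t · X^(d l)` and whose link products are `(∑ l, S l t (t+1) X^(d l)) · (∑ l, S l (t+1) t X^(d l))`; for a STATIC
pencil (one class per entry) these are single monomials. [folklore] -/
theorem det_pencil_of_tridiagonal {m K : ℕ} (d : Fin K → ℕ) (S : Fin K → Matrix (Fin m) (Fin m) ℝ)
    (htri : ∀ l (i j : Fin m), (i : ℕ) + 1 < j ∨ (j : ℕ) + 1 < i → S l i j = 0) :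
    (∑ l, (X : ℝ[X]) ^ d l • (S l).map C).det =
      ctK (fun t => if h : t < m then (∑ l, (X : ℝ[X]) ^ d l • (S l).map C) ⟨t, h⟩ ⟨t, h⟩ else 0)
        (fun t => -(if h : t + 1 < m then (∑ l, (X : ℝ[X]) ^ d l • (S l).map C) ⟨t, by omega⟩ ⟨t + 1, h⟩ else 0))
        (fun t => if h : 1 ≤ t ∧ t < m then (∑ l, (X : ℝ[X]) ^ d l • (S l).map C) ⟨t, h.2⟩ ⟨t - 1, by omega⟩ else 0) m :=
  det_of_tridiagonal _ (pencil_tridiagonal d S htri)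

end Pencil


/-! ## §4 (appended, same seat and session): the `m = 10` witness computed THROUGH the normal form — ten positive zeros on nine edges
The excess over the edge count (`m = 5`: `…TridiagonalRealStaticFive`, p549470; `m = 6`: `…StaticTridiagonalDefiniteSix`, lift-p2 g8)
persists under concatenation of blocks: a static definite symmetric tridiagonal `10 × 10` monomial matrix with `≥ 10` distinct positive
determinant zeros, certified by sign alternation at eleven rational points after expanding `det` with `det_ctPath` (no `10 × 10` Leibniz
expansion needed).  Located context (seat memo REAL-STATIC-TRIDIAGONAL-liftp3g8.md §4): no instance with more than `m` zeros is known. -/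

section Ten

open Polynomial
open Summit.ValiantsHypothesis.ValiantsHypothesis.Theorems.ValuativeFlip (ctK_zero ctK_one)
open Summit.ValiantsHypothesis.ValiantsHypothesis.Theorems.SymmetroidDescartes (le_card_posRoots_of_alternating)

/-- Closed form of the determinant of the `10 × 10` witness (a STATIC DEFINITE symmetric tridiagonal matrix of monomials, written as the
path matrix of its diagonal `(X, 1, 4X, 1, 1, 2¹⁸, X, 2⁸, X, 2⁶⁰·X)` and its off-diagonal `(1, X, 4X, X⁵, X³, 2¹², X, 4X, X⁶)`; edge weights
`W = (x⁻¹, x/4, 4x, x¹⁰ | 2⁻¹⁸x⁶ | 2⁶x⁻¹, 2⁻⁸x, 2⁻⁴x, 2⁻⁶⁰x¹⁰)` = two copies of the `m = 5` block of `…TridiagonalRealStaticFive`, the second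
active near `x = 64`, joined by a fast edge crossing near `x = 8`), through the continuant normal form `det_ctPath`. [data of this seat] -/
theorem eval_det_ten (t : ℝ) :
    ((ctPath
      (fun t : ℕ => if t = 0 then (X : ℝ[X]) else if t = 1 then (1 : ℝ[X]) else if t = 2 then (C (4 : ℝ) * X : ℝ[X]) else if t = 3 then (1 : ℝ[X]) else if t = 4 then (1 : ℝ[X]) else if t = 5 then (C (262144 : ℝ) : ℝ[X]) else if t = 6 then (X : ℝ[X]) else if t = 7 then (C (256 : ℝ) : ℝ[X]) else if t = 8 then (X : ℝ[X]) else if t = 9 then (C (1152921504606846976 : ℝ) * X : ℝ[X]) else (0 : ℝ[X]))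
      (fun t : ℕ => if t = 0 then (1 : ℝ[X]) else if t = 1 then (X : ℝ[X]) else if t = 2 then (C (4 : ℝ) * X : ℝ[X]) else if t = 3 then (X ^ 5 : ℝ[X]) else if t = 4 then (X ^ 3 : ℝ[X]) else if t = 5 then (C (4096 : ℝ) : ℝ[X]) else if t = 6 then (X : ℝ[X]) else if t = 7 then (C (4 : ℝ) * X : ℝ[X]) else if t = 8 then (X ^ 6 : ℝ[X]) else (0 : ℝ[X]))
      (fun t : ℕ => if t = 0 then (0 : ℝ[X]) else if t = 1 then (1 : ℝ[X]) else if t = 2 then (X : ℝ[X]) else if t = 3 then (C (4 : ℝ) * X : ℝ[X]) else if t = 4 then (X ^ 5 : ℝ[X]) else if t = 5 then (X ^ 3 : ℝ[X]) else if t = 6 then (C (4096 : ℝ) : ℝ[X]) else if t = 7 then (X : ℝ[X]) else if t = 8 then (C (4 : ℝ) * X : ℝ[X]) else if t = 9 then (X ^ 6 : ℝ[X]) else (0 : ℝ[X])) 10).det).eval t =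
      (262144 : ℝ) * t ^ 27 +
      (-68157440 : ℝ) * t ^ 26 +
      (4564451328 : ℝ) * t ^ 25 +
      (-17448304640 : ℝ) * t ^ 24 +
      (17179869201 : ℝ) * t ^ 23 +
      (-4372 : ℝ) * t ^ 22 +
      (5124 : ℝ) * t ^ 21 +
      (-1024 : ℝ) * t ^ 20 +
      (-5137934733362173996957696 : ℝ) * t ^ 17 +
      (407408001210130033022074880 : ℝ) * t ^ 16 +
      (-6519736945181695213548077056 : ℝ) * t ^ 15 +
      (21354465677672809828177674240 : ℝ) * t ^ 14 +
      (-19807040961760399246944632832 : ℝ) * t ^ 13 +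
      (5409507699615326011392 : ℝ) * t ^ 12 +
      (-5981356765900322111488 : ℝ) * t ^ 11 +
      (1180591620717411303424 : ℝ) * t ^ 10 +
      (87344890467156957872521216 : ℝ) * t ^ 7 +
      (-6679315153370826190251622400 : ℝ) * t ^ 6 +
      (91937599655872934107229978624 : ℝ) * t ^ 5 +
      (-100582628191937147335553843200 : ℝ) * t ^ 4 +
      (19807040628566084398385987584 : ℝ) * t ^ 3 := by
  rw [det_ctPath]
  simp only [ctK_add_two, ctK_one, ctK_zero]
  norm_num [eval_add, eval_sub, eval_mul, eval_neg, eval_pow, eval_C, eval_X]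
  ring

/-- **At least ten distinct positive zeros on nine edges**: the determinant of the `10 × 10` witness alternates in sign
(`+,−,+,−,+,−,+,−,+,−,+`) at `t = 1/4, 1/2, 9/8, 11/8, 15/8, 3, 24, 64, 84, 112, 192`. [data of this seat] -/
theorem ten_le_card_posRoots :
    10 ≤ (((ctPath
      (fun t : ℕ => if t = 0 then (X : ℝ[X]) else if t = 1 then (1 : ℝ[X]) else if t = 2 then (C (4 : ℝ) * X : ℝ[X]) else if t = 3 then (1 : ℝ[X]) else if t = 4 then (1 : ℝ[X]) else if t = 5 then (C (262144 : ℝ) : ℝ[X]) else if t = 6 then (X : ℝ[X]) else if t = 7 then (C (256 : ℝ) : ℝ[X]) else if t = 8 then (X : ℝ[X]) else if t = 9 then (C (1152921504606846976 : ℝ) * X : ℝ[X]) else (0 : ℝ[X]))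
      (fun t : ℕ => if t = 0 then (1 : ℝ[X]) else if t = 1 then (X : ℝ[X]) else if t = 2 then (C (4 : ℝ) * X : ℝ[X]) else if t = 3 then (X ^ 5 : ℝ[X]) else if t = 4 then (X ^ 3 : ℝ[X]) else if t = 5 then (C (4096 : ℝ) : ℝ[X]) else if t = 6 then (X : ℝ[X]) else if t = 7 then (C (4 : ℝ) * X : ℝ[X]) else if t = 8 then (X ^ 6 : ℝ[X]) else (0 : ℝ[X]))
      (fun t : ℕ => if t = 0 then (0 : ℝ[X]) else if t = 1 then (1 : ℝ[X]) else if t = 2 then (X : ℝ[X]) else if t = 3 then (C (4 : ℝ) * X : ℝ[X]) else if t = 4 then (X ^ 5 : ℝ[X]) else if t = 5 then (X ^ 3 : ℝ[X]) else if t = 6 then (C (4096 : ℝ) : ℝ[X]) else if t = 7 then (X : ℝ[X]) else if t = 8 then (C (4 : ℝ) * X : ℝ[X]) else if t = 9 then (X ^ 6 : ℝ[X]) else (0 : ℝ[X])) 10).det).roots.toFinset.filter (fun t => 0 < t)).card := by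
  refine le_card_posRoots_of_alternating _ 10
    (![1/4, 1/2, 9/8, 11/8, 15/8, 3, 24, 64, 84, 112, 192] : Fin 11 → ℝ) ?_ ?_ ?_
  · refine Fin.strictMono_iff_lt_succ.2 fun j => ?_
    fin_cases j <;> simp only [Fin.castSucc_mk, Fin.succ_mk] <;> norm_num
  · intro j; fin_cases j <;> norm_num
  · intro j; fin_cases j <;> simp only [eval_det_ten, Fin.castSucc_mk, Fin.succ_mk] <;> norm_num

/-- The `10 × 10` witness in the desk's typed currency (R2102/R2114): with the (natural-number) coefficient table `c` and the exponent
table `e` below (read off the three diagonals), the monomial matrix `of (fun i j => C (c i j) * X ^ (e i j))` IS the path matrix of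
`eval_det_ten`. [data of this seat] -/
theorem of_eq_ctPath_ten :
    (Matrix.of fun i j : Fin 10 =>
        C (((fun i j : Fin 10 => (if (j : ℕ) = i then (fun t : ℕ => if t = 0 then 1 else if t = 1 then 1 else if t = 2 then 4 else if t = 3 then 1 else if t = 4 then 1 else if t = 5 then 262144 else if t = 6 then 1 else if t = 7 then 256 else if t = 8 then 1 else if t = 9 then 1152921504606846976 else 0) i else if (j : ℕ) = i + 1 then (fun t : ℕ => if t = 0 then 1 else if t = 1 then 1 else if t = 2 then 4 else if t = 3 then 1 else if t = 4 then 1 else if t = 5 then 4096 else if t = 6 then 1 else if t = 7 then 4 else if t = 8 then 1 else 0) i else if (i : ℕ) = j + 1 then (fun t : ℕ => if t = 0 then 1 else if t = 1 then 1 else if t = 2 then 4 else if t = 3 then 1 else if t = 4 then 1 else if t = 5 then 4096 else if t = 6 then 1 else if t = 7 then 4 else if t = 8 then 1 else 0) j else 0 : ℕ)) i j : ℕ) : ℝ) * (X : ℝ[X]) ^ ((fun i j : Fin 10 => (if (j : ℕ) = i then (fun t : ℕ => if t = 0 then 1 else if t = 1 then 0 else if t = 2 then 1 else if t = 3 then 0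 else if t = 4 then 0 else if t = 5 then 0 else if t = 6 then 1 else if t = 7 then 0 else if t = 8 then 1 else if t = 9 then 1 else 0) i else if (j : ℕ) = i + 1 then (fun t : ℕ => if t = 0 then 0 else if t = 1 then 1 else if t = 2 then 1 else if t = 3 then 5 else if t = 4 then 3 else if t = 5 then 0 else if t = 6 then 1 else if t = 7 then 1 else if t = 8 then 6 else 0) i else if (i : ℕ) = j + 1 then (fun t : ℕ => if t = 0 then 0 else if t = 1 then 1 else if t = 2 then 1 else if t = 3 then 5 else if t = 4 then 3 else if t = 5 then 0 else if t = 6 then 1 else if t = 7 then 1 else if t = 8 then 6 else 0) j else 0 : ℕ)) i j)) =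
      (ctPath
      (fun t : ℕ => if t = 0 then (X : ℝ[X]) else if t = 1 then (1 : ℝ[X]) else if t = 2 then (C (4 : ℝ) * X : ℝ[X]) else if t = 3 then (1 : ℝ[X]) else if t = 4 then (1 : ℝ[X]) else if t = 5 then (C (262144 : ℝ) : ℝ[X]) else if t = 6 then (X : ℝ[X]) else if t = 7 then (C (256 : ℝ) : ℝ[X]) else if t = 8 then (X : ℝ[X]) else if t = 9 then (C (1152921504606846976 : ℝ) * X : ℝ[X]) else (0 : ℝ[X]))
      (fun t : ℕ => if t = 0 then (1 : ℝ[X]) else if t = 1 then (X : ℝ[X]) else if t = 2 then (C (4 : ℝ) * X : ℝ[X]) else if t = 3 then (X ^ 5 : ℝ[X]) else if t = 4 then (X ^ 3 : ℝ[X]) else if t = 5 then (C (4096 : ℝ) : ℝ[X]) else if t = 6 then (X : ℝ[X]) else if t = 7 then (C (4 : ℝ) * X : ℝ[X]) else if t = 8 then (X ^ 6 : ℝ[X]) else (0 : ℝ[X]))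
      (fun t : ℕ => if t = 0 then (0 : ℝ[X]) else if t = 1 then (1 : ℝ[X]) else if t = 2 then (X : ℝ[X]) else if t = 3 then (C (4 : ℝ) * X : ℝ[X]) else if t = 4 then (X ^ 5 : ℝ[X]) else if t = 5 then (X ^ 3 : ℝ[X]) else if t = 6 then (C (4096 : ℝ) : ℝ[X]) else if t = 7 then (X : ℝ[X]) else if t = 8 then (C (4 : ℝ) * X : ℝ[X]) else if t = 9 then (X ^ 6 : ℝ[X]) else (0 : ℝ[X])) 10) := by
  ext i j
  simp only [Matrix.of_apply, ctPath_apply]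
  have hi : (i : ℕ) < 10 := i.isLt
  have hj : (j : ℕ) < 10 := j.isLt
  by_cases h1 : (j : ℕ) = i
  · simp only [h1, if_true]
    generalize (i : ℕ) = t at hi ⊢
    interval_cases t <;> simp
  · rw [if_neg h1, if_neg h1, if_neg h1]
    by_cases h2 : (j : ℕ) = i + 1
    · simp only [h2, if_true]
      have hi' : (i : ℕ) < 9 := by omega
      generalize (i : ℕ) = t at hi' ⊢
      interval_cases t <;> simp
    · rw [if_neg h2, if_neg h2, if_neg h2]
      by_cases h3 : (i : ℕ) = j + 1
      · simp only [h3, if_true]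
        have hj' : (j : ℕ) < 9 := by omega
        generalize (j : ℕ) = t at hj' ⊢
        interval_cases t <;> simp
      · rw [if_neg h3, if_neg h3, if_neg h3]
        simp

/-- **A STATIC DEFINITE SYMMETRIC TRIDIAGONAL `10 × 10` MONOMIAL MATRIX WITH TEN POSITIVE DETERMINANT ZEROS** (nine edges), in the
typed currency of the desk's α target `staticTridiagonal_definite_posRoots_le` (R2102/R2114: `c`, `e` symmetric, `c = 0` off the band,
`0 < c i i`): the excess over the edge count found at `m = 5` (`…TridiagonalRealStaticFive`) and `m = 6` (`…StaticTridiagonalDefiniteSix`,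
lift-p2 g8) PERSISTS under concatenation — any linear law `B m` for the sub-sector has `B 10 ≥ 10`. [data of this seat] -/
theorem exists_static_definite_tridiagonal_ten :
    ∃ (c : Fin 10 → Fin 10 → ℝ) (e : Fin 10 → Fin 10 → ℕ),
      (∀ i j, c i j = c j i) ∧ (∀ i j, e i j = e j i) ∧
      (∀ i j : Fin 10, (i : ℕ) + 1 < j ∨ (j : ℕ) + 1 < i → c i j = 0) ∧ (∀ i, 0 < c i i) ∧
      10 ≤ ((Matrix.det (Matrix.of fun i j => C (c i j) * (X : ℝ[X]) ^ (e i j))).roots.toFinset.filter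
        (fun t => 0 < t)).card := by
  refine ⟨fun i j => (((fun i j : Fin 10 => (if (j : ℕ) = i then (fun t : ℕ => if t = 0 then 1 else if t = 1 then 1 else if t = 2 then 4 else if t = 3 then 1 else if t = 4 then 1 else if t = 5 then 262144 else if t = 6 then 1 else if t = 7 then 256 else if t = 8 then 1 else if t = 9 then 1152921504606846976 else 0) i else if (j : ℕ) = i + 1 then (fun t : ℕ => if t = 0 then 1 else if t = 1 then 1 else if t = 2 then 4 else if t = 3 then 1 else if t = 4 then 1 else if t = 5 then 4096 else if t = 6 then 1 else if t = 7 then 4 else if t = 8 then 1 else 0) i else if (i : ℕ) = j + 1 then (fun t : ℕ => if t = 0 then 1 else if t = 1 then 1 else if t = 2 then 4 else if t = 3 then 1 else if t = 4 then 1 else if t = 5 then 4096 else if t = 6 then 1 else if t = 7 then 4 else if t = 8 then 1 else 0) j else 0 : ℕ)) i j : ℕ) : ℝ), (fun i j : Fin 10 => (if (j : ℕ) = i then (fun t : ℕ => if t = 0 then 1 else if t = 1 then 0 else if t = 2 then 1 else if t = 3 then 0 else if t = 4 then 0 else if t = 5 then 0 else if t = 6 then 1 else if t = 7 then 0 else if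 t = 8 then 1 else if t = 9 then 1 else 0) i else if (j : ℕ) = i + 1 then (fun t : ℕ => if t = 0 then 0 else if t = 1 then 1 else if t = 2 then 1 else if t = 3 then 5 else if t = 4 then 3 else if t = 5 then 0 else if t = 6 then 1 else if t = 7 then 1 else if t = 8 then 6 else 0) i else if (i : ℕ) = j + 1 then (fun t : ℕ => if t = 0 then 0 else if t = 1 then 1 else if t = 2 then 1 else if t = 3 then 5 else if t = 4 then 3 else if t = 5 then 0 else if t = 6 then 1 else if t = 7 then 1 else if t = 8 then 6 else 0) j else 0 : ℕ)), ?_, ?_, ?_, ?_, ?_⟩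
  · have h : ∀ i j : Fin 10, (fun i j : Fin 10 => (if (j : ℕ) = i then (fun t : ℕ => if t = 0 then 1 else if t = 1 then 1 else if t = 2 then 4 else if t = 3 then 1 else if t = 4 then 1 else if t = 5 then 262144 else if t = 6 then 1 else if t = 7 then 256 else if t = 8 then 1 else if t = 9 then 1152921504606846976 else 0) i else if (j : ℕ) = i + 1 then (fun t : ℕ => if t = 0 then 1 else if t = 1 then 1 else if t = 2 then 4 else if t = 3 then 1 else if t = 4 then 1 else if t = 5 then 4096 else if t = 6 then 1 else if t = 7 then 4 else if t = 8 then 1 else 0) i else if (i : ℕ) = j + 1 then (fun t : ℕ => if t = 0 then 1 else if t = 1 then 1 else if t = 2 then 4 else if t = 3 then 1 else if t = 4 then 1 else if t = 5 then 4096 else if t = 6 then 1 else if t = 7 then 4 else if t = 8 then 1 else 0) j else 0 : ℕ)) i j = (fun i j : Fin 10 => (if (j : ℕ) = i then (fun t : ℕ => if t = 0 then 1 else if t = 1 then 1 else if t = 2 then 4 else if t = 3 then 1 else if t = 4 then 1 else if t = 5 then 262144 else if t = 6 then 1 else if t = 7 then 256 else if t = 8 then 1 else if t = 9 then 1152921504606846976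 else 0) i else if (j : ℕ) = i + 1 then (fun t : ℕ => if t = 0 then 1 else if t = 1 then 1 else if t = 2 then 4 else if t = 3 then 1 else if t = 4 then 1 else if t = 5 then 4096 else if t = 6 then 1 else if t = 7 then 4 else if t = 8 then 1 else 0) i else if (i : ℕ) = j + 1 then (fun t : ℕ => if t = 0 then 1 else if t = 1 then 1 else if t = 2 then 4 else if t = 3 then 1 else if t = 4 then 1 else if t = 5 then 4096 else if t = 6 then 1 else if t = 7 then 4 else if t = 8 then 1 else 0) j else 0 : ℕ)) j i := by decide
    intro i j
    exact congrArg (Nat.cast (R := ℝ)) (h i j)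
  · decide
  · have h : ∀ i j : Fin 10, (i : ℕ) + 1 < j ∨ (j : ℕ) + 1 < i → (fun i j : Fin 10 => (if (j : ℕ) = i then (fun t : ℕ => if t = 0 then 1 else if t = 1 then 1 else if t = 2 then 4 else if t = 3 then 1 else if t = 4 then 1 else if t = 5 then 262144 else if t = 6 then 1 else if t = 7 then 256 else if t = 8 then 1 else if t = 9 then 1152921504606846976 else 0) i else if (j : ℕ) = i + 1 then (fun t : ℕ => if t = 0 then 1 else if t = 1 then 1 else if t = 2 then 4 else if t = 3 then 1 else if t = 4 then 1 else if t = 5 then 4096 else if t = 6 then 1 else if t = 7 then 4 else if t = 8 then 1 else 0) i else if (i : ℕ) = j + 1 then (fun t : ℕ => if t = 0 then 1 else if t = 1 then 1 else if t = 2 then 4 else if t = 3 then 1 else if t = 4 then 1 else if t = 5 then 4096 else if t = 6 then 1 else if t = 7 then 4 else if t = 8 then 1 else 0) j else 0 : ℕ)) i j = 0 := by decide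
    intro i j hij
    have h' := h i j hij
    beta_reduce at h' ⊢
    rw [h', Nat.cast_zero]
  · have h : ∀ i : Fin 10, 0 < (fun i j : Fin 10 => (if (j : ℕ) = i then (fun t : ℕ => if t = 0 then 1 else if t = 1 then 1 else if t = 2 then 4 else if t = 3 then 1 else if t = 4 then 1 else if t = 5 then 262144 else if t = 6 then 1 else if t = 7 then 256 else if t = 8 then 1 else if t = 9 then 1152921504606846976 else 0) i else if (j : ℕ) = i + 1 then (fun t : ℕ => if t = 0 then 1 else if t = 1 then 1 else if t = 2 then 4 else if t = 3 then 1 else if t = 4 then 1 else if t = 5 then 4096 else if t = 6 then 1 else if t = 7 then 4 else if t = 8 then 1 else 0) i else if (i : ℕ) = j + 1 then (fun t : ℕ => if t = 0 then 1 else if t = 1 then 1 else if t = 2 then 4 else if t = 3 then 1 else if t = 4 then 1 else if t = 5 then 4096 else if t = 6 then 1 else if t = 7 then 4 else if t = 8 then 1 else 0) j else 0 : ℕ)) i i := by decide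
    intro i
    have h' := h i
    beta_reduce at h' ⊢
    exact_mod_cast h'
  · rw [of_eq_ctPath_ten]
    exact ten_le_card_posRoots

/-- **«ONE ZERO PER EDGE» FAILS BY ONE AT `m = 10` TOO**: it is false that every static definite symmetric tridiagonal `10 × 10` monomial
matrix has at most `9 = 10 − 1` distinct positive determinant zeros. [corollary] -/
theorem not_posRoots_le_edges_static_tridiagonal_ten :
    ¬ (∀ (c : Fin 10 → Fin 10 → ℝ) (e : Fin 10 → Fin 10 → ℕ), (∀ i j, c i j = c j i) → (∀ i j, e i j = e j i) →
        (∀ i j : Fin 10, (i : ℕ) + 1 < j ∨ (j : ℕ) + 1 < i → c i j = 0) → (∀ i, 0 < c i i) →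
        ((Matrix.det (Matrix.of fun i j => C (c i j) * (X : ℝ[X]) ^ (e i j))).roots.toFinset.filter
          (fun t => 0 < t)).card ≤ 10 - 1) := by
  intro h
  obtain ⟨c, e, hc, he, htri, hpos, h10⟩ := exists_static_definite_tridiagonal_ten
  have := h c e hc he htri hpos
  omega

end Ten

end Summit.ValiantsHypothesis.ValiantsHypothesis.Theorems.KPlusLogSqLaw.StaticTridiagonalReal
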